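import Mathlib

/-!
# Crux `IntegralOrbits.IntDetQP` (stmt-ValiantsHypothesis-7677), line `birth` — registered stub
`stub_liftAssembly` (L5): assembly of the FREE-DENOMINATOR LIFT

From the four elementary statements of the skeleton —
L1 (short word basis), L2 (determinant of the generic pencil of the left-regular representation
in any basis), L3 (trace-form Cramer rule for the coordinates) and L4 (crude integer bounds for
`det` and `adj`) — we assemble the free-denominator lift: an absolutely irreducible tuple
`M : ι → M_m(ℂ)` whose character takes values `z / N ^ e` with `|z| ≤ 2 ^ (h (|w| + 1))`,
`e ≤ h (|w| + 1)` admits integer matrices `Z_v` of size `m²`, a denominator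
`1 ≤ D ≤ 2 ^ ((m + #ι + h + 2) ^ 10)` and entries of the same height, with
`det (X₀ + Σ_v X_v Z_v / D) = det (X₀ + Σ_v X_v M_v) ^ m`.

Proof.  For `m = 0` everything is an empty determinant.  For `m ≥ 1` take the word basis
`B_i = wp (b_i)` of L1 (`|b_i| ≤ m²`), the coordinates `C_v` of left multiplication by `M_v`
(`Basis.repr`), the Gram matrix `G_{ij} = tr (B_i B_j) = tr wp (b_i ++ b_j)` and
`T_v = (tr (B_i M_v B_j))`.  All these traces are characters of words of length `≤ 2m² + 1`, so
with `E = h (2m² + 2)` the matrices `G̃ = N^E G`, `T̃_v = N^E T_v` are integral with entries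
`≤ 2 ^ (E (h + 1)) =: K`.  By L3, `det G̃ ≠ 0` and `adj G̃ · T̃_v = det G̃ · C_v`; put
`D = |det G̃|`, `Z_v = sign (det G̃) · adj G̃ · T̃_v`, so `Z_v / D = C_v` and L2 gives the
determinant identity with `r = m`.  L4 bounds `D` and `adj G̃` by `(m²)! K^{m²}`, whence
`|Z_v| ≤ m² (m²)! K^{m² + 1} ≤ 2 ^ ((m + #ι + h + 2) ^ 10)`.
-/

set_option linter.dupNamespace false -- single-conjunct summit

namespace Summit.ValiantsHypothesis.ValiantsHypothesis.Theorems

namespace IntegralOrbitsIntDetQPLiftAssembly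

/-- Word products are multiplicative: `wp (u ++ w) = wp u * wp w`. [folklore] -/
theorem wordProd_append {ι R : Type*} [Monoid R] (M : ι → R) (u w : List ι) :
    ((u ++ w).map M).prod = (u.map M).prod * (w.map M).prod := by
  rw [List.map_append, List.prod_append]

/-- `wp (u ++ v :: w) = wp u * (M v * wp w)`. [folklore] -/
theorem wordProd_append_cons {ι R : Type*} [Monoid R] (M : ι → R) (u w : List ι) (v : ι) :
    ((u ++ v :: w).map M).prod = (u.map M).prod * (M v * (w.map M).prod) := by
  rw [List.map_append, List.map_cons, List.prod_append, List.prod_cons]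

/-- Clearing the denominator of `z / N ^ e` by `N ^ E`, `e ≤ E`. [folklore] -/
theorem cast_integerise {N : ℕ} (hN : (N : ℂ) ≠ 0) {e E : ℕ} (he : e ≤ E) (z : ℤ) :
    ((z * (N : ℤ) ^ (E - e) : ℤ) : ℂ) = (N : ℂ) ^ E * ((z : ℂ) / (N : ℂ) ^ e) := by
  obtain ⟨k, rfl⟩ := Nat.exists_eq_add_of_le he
  rw [Nat.add_sub_cancel_left, pow_add]
  push_cast
  field_simp

/-- The sign trick: if `w = d • x` with `d ≠ 0` an integer, then `sign d • w / |d| = x`.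
[folklore] -/
theorem sign_fix {d w : ℤ} {x : ℂ} (hd : d ≠ 0) (hw : (w : ℂ) = (d : ℂ) * x) :
    ((Int.sign d * w : ℤ) : ℂ) / ((d.natAbs : ℕ) : ℂ) = x := by
  have hD : ((d.natAbs : ℕ) : ℂ) = (Int.sign d : ℂ) * (d : ℂ) := by
    rw [← Int.cast_natCast, ← Int.sign_mul_self_eq_natAbs, Int.cast_mul]
  have hD0 : ((d.natAbs : ℕ) : ℂ) ≠ 0 := Nat.cast_ne_zero.mpr (Int.natAbs_ne_zero.mpr hd)
  rw [div_eq_iff hD0, Int.cast_mul, hw, hD]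
  ring

/-- Height of an integerised character value: `|z · N^(E-e)| ≤ 2 ^ (E (h + 1))` when
`|z| ≤ 2 ^ E` and `N ≤ 2 ^ h`. [folklore] -/
theorem entry_bound {z : ℤ} {N E e h : ℕ} (hz : |z| ≤ 2 ^ E) (hN : N ≤ 2 ^ h) :
    |z * (N : ℤ) ^ (E - e)| ≤ ((2 ^ (E * (h + 1)) : ℕ) : ℤ) := by
  rw [abs_mul, abs_pow, Nat.abs_cast]
  have h1 : (N : ℤ) ^ (E - e) ≤ 2 ^ (h * E) :=
    calc (N : ℤ) ^ (E - e) ≤ (2 ^ h) ^ (E - e) :=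
          pow_le_pow_left₀ (Nat.cast_nonneg N) (by exact_mod_cast hN) _
      _ ≤ (2 ^ h) ^ E := pow_le_pow_right₀ (one_le_pow₀ one_le_two) (Nat.sub_le E e)
      _ = 2 ^ (h * E) := (pow_mul 2 h E).symm
  calc |z| * (N : ℤ) ^ (E - e) ≤ 2 ^ E * 2 ^ (h * E) :=
        mul_le_mul hz h1 (pow_nonneg (Nat.cast_nonneg N) _) (pow_nonneg zero_le_two _)
    _ = ((2 ^ (E * (h + 1)) : ℕ) : ℤ) := by push_cast; ring

/-- A crude bound for an entry of a product of integer matrices. [folklore] -/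
theorem abs_sum_mul_le {n : Type*} [Fintype n] {a t : n → ℤ} {X K : ℤ} (ha : ∀ j, |a j| ≤ X)
    (ht : ∀ j, |t j| ≤ K) : |∑ j, a j * t j| ≤ Fintype.card n * (X * K) :=
  calc |∑ j, a j * t j| ≤ ∑ j, |a j * t j| := Finset.abs_sum_le_sum_abs _ _
    _ ≤ ∑ _j : n, X * K := Finset.sum_le_sum fun j _ => by
        rw [abs_mul]
        exact mul_le_mul (ha j) (ht j) (abs_nonneg _) ((abs_nonneg _).trans (ha j))
    _ = Fintype.card n * (X * K) := by rw [Finset.sum_const, Finset.card_univ, nsmul_eq_mul]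

/-- The determinant of an integer matrix whose complexification is `c • G`. [folklore] -/
theorem cast_det_of_map_eq {n : Type*} [Fintype n] [DecidableEq n] {G : Matrix n n ℂ}
    {Gt : Matrix n n ℤ} {c : ℂ} (hG : Gt.map (fun x : ℤ => (x : ℂ)) = c • G) :
    (Gt.det : ℂ) = c ^ Fintype.card n * G.det := by
  rw [Int.cast_det, hG, Matrix.det_smul]

/-- **Integral Cramer rule.**  If `G̃ = c • G` and `T̃ = c • T` are integral and
`det G • C = adj G * T`, then `adj G̃ * T̃ = det G̃ • C`. [folklore] -/
theorem integral_cramer {n : Type*} [Fintype n] [DecidableEq n] [Nonempty n]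
    {G T C : Matrix n n ℂ} {Gt Tt : Matrix n n ℤ} {c : ℂ}
    (hG : Gt.map (fun x : ℤ => (x : ℂ)) = c • G) (hT : Tt.map (fun x : ℤ => (x : ℂ)) = c • T)
    (hCr : G.det • C = G.adjugate * T) :
    (Gt.adjugate * Tt).map (fun x : ℤ => (x : ℂ)) = (Gt.det : ℂ) • C := by
  have hadj : Gt.adjugate.map (fun x : ℤ => (x : ℂ)) =
      (Gt.map (fun x : ℤ => (x : ℂ))).adjugate := by
    simpa only [RingHom.mapMatrix_apply, Int.coe_castRingHom] using
      (Int.castRingHom ℂ).map_adjugate Gt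
  have hmul : (Gt.adjugate * Tt).map (fun x : ℤ => (x : ℂ)) =
      Gt.adjugate.map (fun x : ℤ => (x : ℂ)) * Tt.map (fun x : ℤ => (x : ℂ)) := by
    simpa only [Int.coe_castRingHom] using
      (Matrix.map_mul (L := Gt.adjugate) (M := Tt) (f := Int.castRingHom ℂ))
  rw [hmul, hadj, hG, hT, Matrix.adjugate_smul, Matrix.smul_mul, Matrix.mul_smul, smul_smul,
    ← hCr, smul_smul, cast_det_of_map_eq hG, pow_sub_one_mul Fintype.card_ne_zero]

/-- Exponent bookkeeping: `d + d² + h(2d+2)(h+1)(d+1) ≤ (m+k+h+2)¹⁰` for `d = m²`. [folklore] -/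
theorem expo_bound (m k h : ℕ) :
    m * m + m * m * (m * m) + h * (2 * (m * m) + 2) * (h + 1) * (m * m + 1) ≤
      (m + k + h + 2) ^ 10 := by
  have h2 : 2 ≤ m + k + h + 2 := by omega
  have hm : m ≤ m + k + h + 2 := by omega
  have hh : h ≤ m + k + h + 2 := by omega
  have hh1 : h + 1 ≤ m + k + h + 2 := by omega
  generalize m + k + h + 2 = t at h2 hm hh hh1
  have hd : m * m ≤ t ^ 2 := by rw [sq]; exact Nat.mul_le_mul hm hm
  have ht2 : 1 ≤ t ^ 2 := Nat.one_le_pow _ _ (by omega)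
  have ht4 : 4 ≤ t ^ 2 := by rw [sq]; exact Nat.mul_le_mul h2 h2
  have hA : m * m * (m * m) ≤ t ^ 4 :=
    calc m * m * (m * m) ≤ t ^ 2 * t ^ 2 := Nat.mul_le_mul hd hd
      _ = t ^ 4 := by ring
  have hB : m * m + 1 ≤ t ^ 3 :=
    calc m * m + 1 ≤ t ^ 2 + t ^ 2 := Nat.add_le_add hd ht2
      _ = 2 * t ^ 2 := by ring
      _ ≤ t * t ^ 2 := Nat.mul_le_mul_right _ h2
      _ = t ^ 3 := by ring
  have hC : 2 * (m * m) + 2 ≤ t ^ 4 :=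
    calc 2 * (m * m) + 2 ≤ 2 * t ^ 2 + 2 * t ^ 2 :=
          Nat.add_le_add (Nat.mul_le_mul_left 2 hd) (by omega)
      _ = 4 * t ^ 2 := by ring
      _ ≤ t ^ 2 * t ^ 2 := Nat.mul_le_mul_right _ ht4
      _ = t ^ 4 := by ring
  have hD : h * (2 * (m * m) + 2) * (h + 1) * (m * m + 1) ≤ t ^ 9 :=
    calc h * (2 * (m * m) + 2) * (h + 1) * (m * m + 1) ≤ t * t ^ 4 * t * t ^ 3 :=
          Nat.mul_le_mul (Nat.mul_le_mul (Nat.mul_le_mul hh hC) hh1) hB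
      _ = t ^ 9 := by ring
  have hE : t ^ 2 + t ^ 4 + t ^ 9 ≤ t ^ 10 := by
    have h24 : t ^ 2 ≤ t ^ 4 := Nat.pow_le_pow_right (by omega) (by norm_num)
    have h49 : 2 * t ^ 4 ≤ t ^ 9 :=
      calc 2 * t ^ 4 ≤ t * t ^ 4 := Nat.mul_le_mul_right _ h2
        _ = t ^ 5 := by ring
        _ ≤ t ^ 9 := Nat.pow_le_pow_right (by omega) (by norm_num)
    have h910 : 2 * t ^ 9 ≤ t ^ 10 :=
      calc 2 * t ^ 9 ≤ t * t ^ 9 := Nat.mul_le_mul_right _ h2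
        _ = t ^ 10 := by ring
    omega
  calc _ ≤ t ^ 2 + t ^ 4 + t ^ 9 := Nat.add_le_add (Nat.add_le_add hd hA) hD
    _ ≤ t ^ 10 := hE

/-- Height bookkeeping: `d · d! · K^(d+1) ≤ 2 ^ ((m+k+h+2)¹⁰)` for `d = m²`,
`K = 2 ^ (h(2d+2)(h+1))`. [folklore] -/
theorem height_arith (m k h : ℕ) :
    m * m * ((m * m).factorial * (2 ^ (h * (2 * (m * m) + 2) * (h + 1))) ^ (m * m) *
        2 ^ (h * (2 * (m * m) + 2) * (h + 1))) ≤ 2 ^ ((m + k + h + 2) ^ 10) := by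
  generalize hX : h * (2 * (m * m) + 2) * (h + 1) = X
  have hd : m * m ≤ 2 ^ (m * m) := Nat.lt_two_pow_self.le
  have hf : (m * m).factorial ≤ 2 ^ (m * m * (m * m)) :=
    calc (m * m).factorial ≤ (m * m) ^ (m * m) := Nat.factorial_le_pow _
      _ ≤ (2 ^ (m * m)) ^ (m * m) := Nat.pow_le_pow_left hd _
      _ = 2 ^ (m * m * (m * m)) := (pow_mul _ _ _).symm
  calc m * m * ((m * m).factorial * (2 ^ X) ^ (m * m) * 2 ^ X)
      ≤ 2 ^ (m * m) * (2 ^ (m * m * (m * m)) * (2 ^ X) ^ (m * m) * 2 ^ X) :=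
        Nat.mul_le_mul hd (Nat.mul_le_mul_right _ (Nat.mul_le_mul_right _ hf))
    _ = 2 ^ (m * m + m * m * (m * m) + X * (m * m + 1)) := by ring
    _ ≤ 2 ^ ((m + k + h + 2) ^ 10) :=
        Nat.pow_le_pow_right (by norm_num) (by rw [← hX]; exact expo_bound m k h)

end IntegralOrbitsIntDetQPLiftAssembly

open IntegralOrbitsIntDetQPLiftAssembly in
/-- **Registered stub `stub_liftAssembly` (L5) of the `birth` line of crux
`IntegralOrbits.IntDetQP`: the four statements L1 (short word basis), L2 (regular pencil
determinant), L3 (trace-form Cramer) and L4 (integer adjugate bounds) imply the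
FREE-DENOMINATOR LIFT** with the absolute
constant `c = 10`: word basis `B` from L1, coordinates `C_v` of left multiplication, integerised
Gram data `G̃ = N^E G`, `T̃_v = N^E T_v` (`E = h (2m² + 2)`), `D = |det G̃|`,
`Z_v = sign (det G̃) · adj G̃ · T̃_v` so that `Z_v / D = C_v` (L3), the determinant identity with
`r = m` (L2), and the heights from L4. [folklore] -/
theorem stub_liftAssembly :
    (∀ (ι : Type) [Fintype ι] [DecidableEq ι] (m : ℕ) (M : ι → Matrix (Fin m) (Fin m) ℂ),
      Submodule.span ℂ (Set.range fun w : List ι => (w.map M).prod) = ⊤ →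
      ∃ b : Fin m × Fin m → List ι,
        (∀ i, (b i).length ≤ m * m) ∧ LinearIndependent ℂ (fun i => ((b i).map M).prod)) →
    (∀ (ι : Type) [Fintype ι] [DecidableEq ι] (m : ℕ) (M : ι → Matrix (Fin m) (Fin m) ℂ)
      (b : Fin m × Fin m → Matrix (Fin m) (Fin m) ℂ)
      (Cv : ι → Matrix (Fin m × Fin m) (Fin m × Fin m) ℂ),
      LinearIndependent ℂ b →
      (∀ v j, M v * b j = ∑ i, Cv v i j • b i) →
      ((MvPolynomial.X none : MvPolynomial (Option ι) ℂ) •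
            (1 : Matrix (Fin m × Fin m) (Fin m × Fin m) (MvPolynomial (Option ι) ℂ)) +
          ∑ v : ι, (MvPolynomial.X (some v) : MvPolynomial (Option ι) ℂ) •
            (Cv v).map (MvPolynomial.C : ℂ →+* MvPolynomial (Option ι) ℂ)).det =
        (((MvPolynomial.X none : MvPolynomial (Option ι) ℂ) •
              (1 : Matrix (Fin m) (Fin m) (MvPolynomial (Option ι) ℂ)) +
            ∑ v : ι, (MvPolynomial.X (some v) : MvPolynomial (Option ι) ℂ) •
              (M v).map (MvPolynomial.C : ℂ →+* MvPolynomial (Option ι) ℂ)).det) ^ m) →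
    (∀ (ι : Type) [Fintype ι] [DecidableEq ι] (m : ℕ) (M : ι → Matrix (Fin m) (Fin m) ℂ)
      (b : Fin m × Fin m → Matrix (Fin m) (Fin m) ℂ)
      (Cv : ι → Matrix (Fin m × Fin m) (Fin m × Fin m) ℂ),
      LinearIndependent ℂ b →
      (∀ v j, M v * b j = ∑ i, Cv v i j • b i) →
      (Matrix.of fun i j : Fin m × Fin m => (b i * b j).trace).det ≠ 0 ∧
      ∀ v, (Matrix.of fun i j : Fin m × Fin m => (b i * b j).trace).det • Cv v =
        (Matrix.of fun i j : Fin m × Fin m => (b i * b j).trace).adjugate *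
          Matrix.of fun i j : Fin m × Fin m => (b i * (M v * b j)).trace) →
    (∀ (n : Type) [Fintype n] [DecidableEq n] (A : Matrix n n ℤ) (K : ℕ),
      1 ≤ K → (∀ i j, |A i j| ≤ K) →
      |A.det| ≤ Nat.factorial (Fintype.card n) * K ^ Fintype.card n ∧
      ∀ i j, |A.adjugate i j| ≤ Nat.factorial (Fintype.card n) * K ^ Fintype.card n) →
    ∃ c : ℕ, ∀ (ι : Type) [Fintype ι] [DecidableEq ι] (m N h : ℕ) (M : ι → Matrix (Fin m) (Fin m) ℂ),
      1 ≤ N → N ≤ 2 ^ h →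
      Submodule.span ℂ (Set.range fun w : List ι => (w.map M).prod) = ⊤ →
      (∀ w : List ι, ∃ (z : ℤ) (e : ℕ), ((w.map M).prod).trace = (z : ℂ) / (N : ℂ) ^ e ∧
          |z| ≤ 2 ^ (h * (w.length + 1)) ∧ e ≤ h * (w.length + 1)) →
      ∃ (D r : ℕ) (Z : ι → Matrix (Fin m × Fin m) (Fin m × Fin m) ℤ),
        1 ≤ r ∧ 1 ≤ D ∧ D ≤ 2 ^ ((m + Fintype.card ι + h + 2) ^ c) ∧
        (∀ v a b, |Z v a b| ≤ 2 ^ ((m + Fintype.card ι + h + 2) ^ c)) ∧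
        ((MvPolynomial.X none : MvPolynomial (Option ι) ℂ) •
              (1 : Matrix (Fin m × Fin m) (Fin m × Fin m) (MvPolynomial (Option ι) ℂ)) +
            ∑ v : ι, (MvPolynomial.X (some v) : MvPolynomial (Option ι) ℂ) •
              (Z v).map (fun z : ℤ => (MvPolynomial.C ((z : ℂ) / (D : ℂ)) : MvPolynomial (Option ι) ℂ))).det =
          (((MvPolynomial.X none : MvPolynomial (Option ι) ℂ) •
                (1 : Matrix (Fin m) (Fin m) (MvPolynomial (Option ι) ℂ)) +
              ∑ v : ι, (MvPolynomial.X (some v) : MvPolynomial (Option ι) ℂ) •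
                (M v).map (MvPolynomial.C : ℂ →+* MvPolynomial (Option ι) ℂ)).det) ^ r := by
  intro hL1 hL2 hL3 hL4
  refine ⟨10, ?_⟩
  intro ι _ _ m N h M hN1 hNh hspan hchar
  rcases Nat.eq_zero_or_pos m with rfl | hm
  · -- `m = 0`: empty determinants
    refine ⟨1, 1, fun _ => 0, le_rfl, le_rfl, Nat.one_le_two_pow, fun v a b => a.1.elim0, ?_⟩
    rw [Matrix.det_isEmpty, Matrix.det_isEmpty, one_pow]
  -- `m ≥ 1`
  -- (a) the short word basis
  obtain ⟨b, hblen, hbli⟩ := hL1 ι m M hspan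
  generalize hB : (fun i => ((b i).map M).prod) = B at hbli
  have hBi : ∀ i, B i = ((b i).map M).prod := fun i => by rw [← hB]
  -- (b) it is a basis; coordinates of left multiplication
  haveI : Nonempty (Fin m × Fin m) := ⟨(⟨0, hm⟩, ⟨0, hm⟩)⟩
  have hcard : Fintype.card (Fin m × Fin m) = Module.finrank ℂ (Matrix (Fin m) (Fin m) ℂ) := by
    simp [Module.finrank_matrix]
  obtain ⟨bB, hbB⟩ : ∃ bB : Module.Basis (Fin m × Fin m) ℂ (Matrix (Fin m) (Fin m) ℂ),
      ∀ i, bB i = B i :=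
    ⟨basisOfLinearIndependentOfCardEqFinrank hbli hcard, fun i =>
      congrFun (coe_basisOfLinearIndependentOfCardEqFinrank hbli hcard) i⟩
  obtain ⟨Cv, hCvdef⟩ : ∃ Cv : ι → Matrix (Fin m × Fin m) (Fin m × Fin m) ℂ,
      ∀ v i j, Cv v i j = bB.repr (M v * B j) i :=
    ⟨fun v => Matrix.of fun i j => bB.repr (M v * B j) i, fun _ _ _ => rfl⟩
  have hCv : ∀ v j, M v * B j = ∑ i, Cv v i j • B i := fun v j => by
    conv_lhs => rw [← bB.sum_repr (M v * B j)]
    simp only [hCvdef, hbB]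
  -- (c) L2 and L3
  have hdet := hL2 ι m M B Cv hbli hCv
  obtain ⟨hGne, hCr⟩ := hL3 ι m M B Cv hbli hCv
  -- (d) integerise the Gram data
  choose z e hz using fun i j : Fin m × Fin m => hchar (b i ++ b j)
  choose zT eT hzT using fun (v : ι) (i j : Fin m × Fin m) => hchar (b i ++ v :: b j)
  obtain ⟨E, hE⟩ : ∃ E, E = h * (2 * (m * m) + 2) := ⟨_, rfl⟩
  have hlen2 : ∀ i j : Fin m × Fin m, h * ((b i ++ b j).length + 1) ≤ E := fun i j => by
    rw [hE, List.length_append]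
    have := hblen i; have := hblen j
    exact Nat.mul_le_mul_left h (by omega)
  have hlen3 : ∀ (v : ι) (i j : Fin m × Fin m), h * ((b i ++ v :: b j).length + 1) ≤ E :=
      fun v i j => by
    rw [hE, List.length_append, List.length_cons]
    have := hblen i; have := hblen j
    exact Nat.mul_le_mul_left h (by omega)
  have hN0 : (N : ℂ) ≠ 0 := Nat.cast_ne_zero.mpr (by omega)
  obtain ⟨Gt, hGtdef⟩ : ∃ Gt : Matrix (Fin m × Fin m) (Fin m × Fin m) ℤ,
      ∀ i j, Gt i j = z i j * (N : ℤ) ^ (E - e i j) :=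
    ⟨Matrix.of fun i j => z i j * (N : ℤ) ^ (E - e i j), fun _ _ => rfl⟩
  obtain ⟨Tt, hTtdef⟩ : ∃ Tt : ι → Matrix (Fin m × Fin m) (Fin m × Fin m) ℤ,
      ∀ v i j, Tt v i j = zT v i j * (N : ℤ) ^ (E - eT v i j) :=
    ⟨fun v => Matrix.of fun i j => zT v i j * (N : ℤ) ^ (E - eT v i j), fun _ _ _ => rfl⟩
  have hGt : Gt.map (fun x : ℤ => (x : ℂ)) =
      ((N : ℂ) ^ E) • Matrix.of fun i j : Fin m × Fin m => (B i * B j).trace := by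
    ext i j
    simp only [Matrix.map_apply, Matrix.smul_apply, Matrix.of_apply, smul_eq_mul]
    rw [hGtdef, hBi i, hBi j, ← wordProd_append, (hz i j).1]
    exact cast_integerise hN0 ((hz i j).2.2.trans (hlen2 i j)) _
  have hTt : ∀ v, (Tt v).map (fun x : ℤ => (x : ℂ)) =
      ((N : ℂ) ^ E) • Matrix.of fun i j : Fin m × Fin m => (B i * (M v * B j)).trace := fun v => by
    ext i j
    simp only [Matrix.map_apply, Matrix.smul_apply, Matrix.of_apply, smul_eq_mul]
    rw [hTtdef, hBi i, hBi j, ← wordProd_append_cons, (hzT v i j).1]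
    exact cast_integerise hN0 ((hzT v i j).2.2.trans (hlen3 v i j)) _
  have hW : ∀ v, (Gt.adjugate * Tt v).map (fun x : ℤ => (x : ℂ)) = (Gt.det : ℂ) • Cv v :=
    fun v => integral_cramer hGt (hTt v) (hCr v)
  have hGt0 : Gt.det ≠ 0 := by
    intro h0
    have h1 := cast_det_of_map_eq hGt
    rw [h0, Int.cast_zero] at h1
    exact mul_ne_zero (pow_ne_zero _ (pow_ne_zero _ hN0)) hGne h1.symm
  -- (e) the lift `Z_v = sign (det G̃) • adj G̃ * T̃_v`, `D = |det G̃|`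
  obtain ⟨Z, hZdef⟩ : ∃ Z : ι → Matrix (Fin m × Fin m) (Fin m × Fin m) ℤ,
      ∀ v a b', Z v a b' = Int.sign Gt.det * (Gt.adjugate * Tt v) a b' :=
    ⟨fun v => Matrix.of fun a b' => Int.sign Gt.det * (Gt.adjugate * Tt v) a b', fun _ _ _ => rfl⟩
  have hZC : ∀ v a b', ((Z v a b' : ℤ) : ℂ) / ((Gt.det.natAbs : ℕ) : ℂ) = Cv v a b' :=
      fun v a b' => by
    have hw := congrFun (congrFun (hW v) a) b'
    simp only [Matrix.map_apply, Matrix.smul_apply, smul_eq_mul] at hw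
    rw [hZdef]
    exact sign_fix hGt0 hw
  -- (f) the heights
  obtain ⟨K, hK⟩ : ∃ K : ℕ, K = 2 ^ (E * (h + 1)) := ⟨_, rfl⟩
  have hK1 : 1 ≤ K := hK ▸ Nat.one_le_two_pow
  have hGtb : ∀ i j, |Gt i j| ≤ (K : ℤ) := fun i j => by
    rw [hGtdef, hK]
    exact entry_bound ((hz i j).2.1.trans (pow_le_pow_right₀ one_le_two (hlen2 i j))) hNh
  have hTtb : ∀ v i j, |Tt v i j| ≤ (K : ℤ) := fun v i j => by
    rw [hTtdef, hK]
    exact entry_bound ((hzT v i j).2.1.trans (pow_le_pow_right₀ one_le_two (hlen3 v i j))) hNh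
  obtain ⟨hdetb, hadjb⟩ := hL4 (Fin m × Fin m) Gt K hK1 hGtb
  have hcardn : Fintype.card (Fin m × Fin m) = m * m := by simp
  rw [hcardn] at hdetb hadjb
  have harith := height_arith m (Fintype.card ι) h
  rw [← hE, ← hK] at harith
  have hWb : ∀ v a b', |(Gt.adjugate * Tt v) a b'| ≤
      ((m * m : ℕ) : ℤ) * ((((m * m).factorial : ℕ) : ℤ) * (K : ℤ) ^ (m * m) * (K : ℤ)) :=
      fun v a b' => by
    have := abs_sum_mul_le (fun j => hadjb a j) (fun j => hTtb v j b')
    rw [hcardn] at this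
    rw [Matrix.mul_apply]
    exact this
  refine ⟨Gt.det.natAbs, m, Z, hm, Int.natAbs_pos.mpr hGt0, ?_, fun v a b' => ?_, ?_⟩
  · -- `D ≤ 2 ^ poly`
    have h1 : ((Gt.det.natAbs : ℕ) : ℤ) ≤ (((m * m).factorial * K ^ (m * m) : ℕ) : ℤ) := by
      rw [Int.natCast_natAbs]; exact_mod_cast hdetb
    have h2 : (m * m).factorial * K ^ (m * m) ≤ m * m * ((m * m).factorial * K ^ (m * m) * K) :=
      (Nat.le_mul_of_pos_right _ hK1).trans (Nat.le_mul_of_pos_left _ (Nat.mul_pos hm hm))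
    exact (Nat.cast_le.mp h1).trans (h2.trans harith)
  · -- `|Z v a b| ≤ 2 ^ poly`
    rw [hZdef, abs_mul, Int.abs_sign_of_ne_zero hGt0, one_mul]
    refine (hWb v a b').trans ?_
    exact_mod_cast harith
  · -- the determinant identity
    have hZC' : ∀ v, (Z v).map (fun z : ℤ =>
        (MvPolynomial.C ((z : ℂ) / ((Gt.det.natAbs : ℕ) : ℂ)) : MvPolynomial (Option ι) ℂ)) =
        (Cv v).map (MvPolynomial.C : ℂ →+* MvPolynomial (Option ι) ℂ) := fun v =>
      Matrix.ext fun a b' => by simp only [Matrix.map_apply, hZC]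
    simp only [hZC']
    exact hdet

end Summit.ValiantsHypothesis.ValiantsHypothesis.Theorems
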